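import Literature.AlgebraicGeometry.ModuliOfAbelianVarieties.SiegelModuliOfOpenCharts
import Literature.AlgebraicGeometry.AbelianSchemes.AbelianSchemeOverGlueDataTripleUnitBinder
import Literature.AlgebraicGeometry.Morphisms.GlueDataOfOpens
import Literature.AlgebraicGeometry.Morphisms.ProjectiveMorphism
import HarnessLib

/-!
# F-8 (8δ): the slices glue, and the slice triples glue to a polarised family over `A⁰ = ⋃ V_R` (MFK Prop. 7.6)

[cite: MumfordFogartyKirwan1994, Ch. 7 §2 Proposition 7.6 (p. 136; proof pp. 136–138)]
[cite: MumfordFogartyKirwan1994, Ch. 7 §2 Definition 7.2 (p. 129)]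
[cite: StacksProject, Tag 01JA]

Topic `AlgebraicGeometry/ModuliOfAbelianVarieties`; namespace `Literature.AlgebraicGeometry.ModuliOfAbelianVarieties`.  THEOREMS ONLY
(no def, no instance, no notation, no named fact, no `sorry`).  Cell hodgecm-mathlib (D-0151), F-8 table (B-plan1 (g16) 08:46:52Z)
hand (8δ) «glue data of slices + `Z`» (B-p04 (g20)); CONSUMER = ★ `SiegelFineModuliScheme.classify_of_openCharts`
(`SiegelModuliOfOpenCharts`, B-p08 (g13)): this file PRODUCES its chart inputs `M Z j Gc Ĝc hchart hglue hjcov` from the same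
abstract data — so (8ε) instantiates both at once with the (8β)/(8γ) heads (`Fr := IsFrameOn`, `frOpen := frameOpen`, `hFr`,
the slices `V_R`, `ZV R := Z_R`, `huniv`, `hrep := sliceRepresents`).

[MumfordFogartyKirwan1994] Prop. 7.6, proof (p. 138): the slices `V_R ⊂ H` represent the open sub-functors `𝓕_R`; on `V_R` the
open `W_{RR'}` where the universal family `Z_R` is ALSO `R'`-framed maps to `V_{R'}` by the unique morphism `t_{RR'}` classifying
`Z_R|_{W_{RR'}}`; uniqueness makes `t_{RR} = 𝟙`, `t_{RR'}(W_{RR'}) ⊆ W_{R'R}`, `t_{RR'}(W_{RR'} ∩ W_{RR″}) ⊆ W_{R'R″}` and the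
cocycle automatic (§1–§2: ★ `fr_of_isBaseChangeVia`, ★ `baseChange_isBaseChangeVia`, ★ `IsBaseChangeVia.trans`, ★
`exists_isBaseChangeVia_of_comp`); so the `V_R` glue (★ `Morphisms/GlueDataOfOpens.OpensGlueDatum.glueData`, charts `D.U R = V R`
definitionally) to `A⁰ := D.glued`, a locally Noetherian ℚ-scheme (Mathlib `isLocallyNoetherian_iff_openCover`, structure map glued by
`Scheme.Cover.glueMorphisms` — morphisms to `Spec ℚ` are unique, ★ `hom_ext_specRat`), covered by the open immersions `D.ι R`
(Mathlib `OpenCover.iSup_opensRange`) which overlap EXACTLY along the conditions (`hglue`, ★ `OpensGlueDatum.preimage_range_ι`);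
the classifying relations of the `t_{RR'}`, cancelled against the restriction `Z_{R'}|_{W_{R'R}} → Z_{R'}` (★
`exists_isBaseChangeVia_of_comp`), ARE the five-clause transition relations of triples, and ★ (σ2)
`exists_glueTriple_of_transitions_of_three_le` (triple rigidity over ℚ for `3 ≤ N`; no reducedness; slice unit hypotheses
`unitV` and `hdual` — the F-3 inputs, `hdual` in the letter «Cor. 6.8 Zariski-locally on the base», applied to the glued family whose
charts are the projective `Z_R` (★ `CocycleDatum.isBaseChangeVia_abelianScheme`, `hprojV`) — as binders) glues the `Z_R` to a triple `Z` over `A⁰` whose charts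
along the `D.ι R` are cartesian.

* §1 `fr_baseChange_frOpen`, `fr_baseChange_self`, `exists_transition` (the unique `t_{RR'}` with its pull-back relation);
* §2 for any choice `t`/`ht` of §1: `frOpen_self_eq_top`, `transition_self`, `transition_mem`, `transition_dom`, `transition_cocycle`;
* §3 **`exists_glued_of_representedCharts_of_dualV (hN : 3 ≤ N) (hδ) (hdualV) (unitV) : ∃ M (_ : IsLocallyNoetherian M.left) Z j (_ :
  open immersions) (_ : over ℚ) Gc Ĝc, (∀ R, (ZV R).IsBaseChangeVia Z (j R) (Gc R) (Ĝc R)) ∧ (∀ R R', (j R') ⁻¹ᵁ (j R).opensRange =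
  frOpen (ZV R') R) ∧ ⨆ R, (j R).opensRange = ⊤`** (CORE: dual-pair provider `hdualV` asking only cartesian charts by the slices), its
  form **`…_of_specHom (hprojV) (hdual)`** in the F-3 letter of record (Cor. 6.8 Zariski-locally, projective slices), and edition 1's
  absolute head `exists_glued_of_representedCharts` (corollary).  EDITION 2 (B-p08 (g13), cut from B-p04 (g20) 09:33:22Z; DRIFT-1):
  the open-sub-functor clause `hFr` is asked of ℚ-SCHEMES ONLY (★ `SiegelModuliOfOpenCharts` ed. 2 letters).

HC_CM is proved only modulo the 7 printed citations until rung 0 closes; this file discharges none of them (the F-3 inputs `hdual`,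
`unitV` stay binders, as `D₀` does across the (h7)/F-8 chain).

## References
* [MumfordFogartyKirwan1994] D. Mumford, J. Fogarty, F. Kirwan, *Geometric Invariant Theory*, 3rd ed. (1994), Ch. 7 §2 Prop. 7.6
  (p. 136, proof pp. 136–138), Def. 7.2 (p. 129); Ch. 6 §1 Cor. 6.8 (p. 118).
* [StacksProject] The Stacks Project, Tag 01JA (Glueing schemes), Tag 01LH (Relative glueing).
* [GortzWedhorn2020] U. Görtz, T. Wedhorn, *Algebraic Geometry I*, 2nd ed. (2020), Section (3.5) Prop. 3.10; Thm. 8.9 (p. 212).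
-/

noncomputable section

universe u

open CategoryTheory CategoryTheory.Limits AlgebraicGeometry TopologicalSpace
open Literature.AlgebraicGeometry.AbelianSchemes Literature.AlgebraicGeometry.Morphisms Literature.AlgebraicGeometry.Motives

namespace Literature.AlgebraicGeometry.ModuliOfAbelianVarieties

open PolarizedAbelianSchemeWithLevel AbelianSchemeOver

variable {g N : ℕ} {δ : Fin g → ℕ}

section Slices

variable {ι : Type} (Fr : ∀ ⦃T : Scheme.{0}⦄, PolarizedAbelianSchemeWithLevel g N δ T → ι → Prop)
  (frOpen : ∀ ⦃T : Scheme.{0}⦄, PolarizedAbelianSchemeWithLevel g N δ T → ι → T.Opens)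
  (hFr : ∀ ⦃T T' : Scheme.{0}⦄ [IsLocallyNoetherian T] [IsLocallyNoetherian T'] (_ : T ⟶ Spec (.of ℚ))
    (_ : T' ⟶ Spec (.of ℚ)) (P' : PolarizedAbelianSchemeWithLevel g N δ T) (P'' : PolarizedAbelianSchemeWithLevel g N δ T')
    (u : T' ⟶ T) (G : P''.A.X.left ⟶ P'.A.X.left) (Ĝ : P''.D.hat.X.left ⟶ P'.D.hat.X.left),
    P''.IsBaseChangeVia P' u G Ĝ → ∀ R, (Fr P'' R ↔ u ⁻¹ᵁ frOpen P' R = ⊤))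
  (V : ι → Scheme.{0}) [∀ R, IsLocallyNoetherian (V R)] (fV : ∀ R, V R ⟶ Spec (.of ℚ))
  (ZV : ∀ R, PolarizedAbelianSchemeWithLevel g N δ (V R)) (huniv : ∀ R, Fr (ZV R) R)
  (hrep : ∀ R ⦃T : Scheme.{0}⦄ [IsLocallyNoetherian T] (_fT : T ⟶ Spec (.of ℚ))
    (P' : PolarizedAbelianSchemeWithLevel g N δ T), Fr P' R →
    ∃! v : T ⟶ V R, ∃ (G : P'.A.X.left ⟶ (ZV R).A.X.left) (Ĝ : P'.D.hat.X.left ⟶ (ZV R).D.hat.X.left),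
      P'.IsBaseChangeVia (ZV R) v G Ĝ)

/-! ## §1 The slice restricted to its `R'`-open is `R'`-framed; the transition maps -/

include hFr fV in
/-- `Z_R` restricted to the open `W_{RR'} ⊆ V_R` where it is `R'`-framed IS `R'`-framed (`hFr` at ★ `baseChange_isBaseChangeVia`).
[cite: MumfordFogartyKirwan1994, Ch. 7 §2 Proposition 7.6 (pp. 136–138)] -/
theorem fr_baseChange_frOpen (R R' : ι) : Fr ((ZV R).baseChange (frOpen (ZV R) R').ι) R' :=
  (hFr (fV R) ((frOpen (ZV R) R').ι ≫ fV R) (ZV R) ((ZV R).baseChange (frOpen (ZV R) R').ι) (frOpen (ZV R) R').ι _ _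
    ((ZV R).baseChange_isBaseChangeVia (frOpen (ZV R) R').ι) R').2
    ((ι_preimage_eq_top_iff_le _ _).2 le_rfl)

include hFr huniv fV in
/-- `Z_R` restricted to any open of `V_R` is `R`-framed (★ `fr_of_isBaseChangeVia_of_specHom`, `huniv`).
[cite: MumfordFogartyKirwan1994, Ch. 7 §2 Proposition 7.6 (pp. 136–138)] -/
theorem fr_baseChange_self (R : ι) (W : (V R).Opens) : Fr ((ZV R).baseChange W.ι) R :=
  fr_of_isBaseChangeVia_of_specHom Fr frOpen hFr (fV R) (W.ι ≫ fV R) ((ZV R).baseChange_isBaseChangeVia W.ι) (huniv R)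

include hFr hrep fV in
/-- **The transition map `t_{RR'} : W_{RR'} ⟶ V_{R'}`** ([MumfordFogartyKirwan1994] Prop. 7.6: «the unique morphism classifying
`Z_R|_{W_{RR'}}` into the `R'`-slice»): existence with a pull-back relation, and uniqueness among all maps carrying such a relation
(`hrep R'` on the `R'`-framed triple `Z_R|_{W_{RR'}}`). [cite: MumfordFogartyKirwan1994, Ch. 7 §2 Proposition 7.6 (pp. 136–138)] -/
theorem exists_transition (R R' : ι) :
    ∃ (t : ((frOpen (ZV R) R' : (V R).Opens) : Scheme.{0}) ⟶ V R')
      (G : ((ZV R).baseChange (frOpen (ZV R) R').ι).A.X.left ⟶ (ZV R').A.X.left)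
      (Ĝ : ((ZV R).baseChange (frOpen (ZV R) R').ι).D.hat.X.left ⟶ (ZV R').D.hat.X.left),
      ((ZV R).baseChange (frOpen (ZV R) R').ι).IsBaseChangeVia (ZV R') t G Ĝ ∧
      ∀ (t' : ((frOpen (ZV R) R' : (V R).Opens) : Scheme.{0}) ⟶ V R')
        (G' : ((ZV R).baseChange (frOpen (ZV R) R').ι).A.X.left ⟶ (ZV R').A.X.left)
        (Ĝ' : ((ZV R).baseChange (frOpen (ZV R) R').ι).D.hat.X.left ⟶ (ZV R').D.hat.X.left),
        ((ZV R).baseChange (frOpen (ZV R) R').ι).IsBaseChangeVia (ZV R') t' G' Ĝ' → t' = t := by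
  obtain ⟨t, ⟨G, Ĝ, h⟩, huniq⟩ := hrep R' ((frOpen (ZV R) R').ι ≫ fV R) _ (fr_baseChange_frOpen Fr frOpen hFr V fV ZV R R')
  exact ⟨t, G, Ĝ, h, fun t' G' Ĝ' h' => huniq t' ⟨G', Ĝ', h'⟩⟩

/-! ## §2 The glue datum: `W_{RR} = ⊤`, `t_{RR} = ι`, `t_{RR'}(W_{RR'}) ⊆ W_{R'R}`, triple overlaps, cocycle -/

variable (t : ∀ R R', ((frOpen (ZV R) R' : (V R).Opens) : Scheme.{0}) ⟶ V R')
  (Gt : ∀ R R', ((ZV R).baseChange (frOpen (ZV R) R').ι).A.X.left ⟶ (ZV R').A.X.left)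
  (Ĝt : ∀ R R', ((ZV R).baseChange (frOpen (ZV R) R').ι).D.hat.X.left ⟶ (ZV R').D.hat.X.left)
  (ht : ∀ R R', ((ZV R).baseChange (frOpen (ZV R) R').ι).IsBaseChangeVia (ZV R') (t R R') (Gt R R') (Ĝt R R'))

include hFr huniv fV in
/-- `W_{RR} = V_R`: `Z_R` is `R`-framed (`huniv`), read through ★ `fr_iff_frOpen_eq_top_of_specHom`.
[cite: MumfordFogartyKirwan1994, Ch. 7 §2 Proposition 7.6 (pp. 136–138)] -/
theorem frOpen_self_eq_top (R : ι) : frOpen (ZV R) R = ⊤ :=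
  (fr_iff_frOpen_eq_top_of_specHom Fr frOpen hFr (fV R) (ZV R) R).1 (huniv R)

include hFr huniv hrep fV ht in
/-- `t_{RR}` is the inclusion `W_{RR} ↪ V_R` (both carry a pull-back relation of `Z_R|_{W_{RR}}` to `Z_R`; `hrep R` uniqueness).
[cite: MumfordFogartyKirwan1994, Ch. 7 §2 Proposition 7.6 (pp. 136–138)] -/
theorem transition_self (R : ι) : t R R = (frOpen (ZV R) R).ι := by
  obtain ⟨v, -, huniq⟩ := hrep R ((frOpen (ZV R) R).ι ≫ fV R) _ (fr_baseChange_self Fr frOpen hFr V fV ZV huniv R _)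
  exact (huniq _ ⟨_, _, ht R R⟩).trans (huniq _ ⟨_, _, (ZV R).baseChange_isBaseChangeVia (frOpen (ZV R) R).ι⟩).symm

include hFr huniv ht fV in
/-- `t_{RR'}(W_{RR'}) ⊆ W_{R'R}`: `Z_R|_{W_{RR'}}` is `R`-framed and is a pull-back of `Z_{R'}` along `t_{RR'}` (`hFr`).
[cite: MumfordFogartyKirwan1994, Ch. 7 §2 Proposition 7.6 (pp. 136–138)] -/
theorem transition_mem (R R' : ι) (x : frOpen (ZV R) R') : t R R' x ∈ frOpen (ZV R') R :=
  (preimage_eq_top_iff_forall_mem (t R R') (frOpen (ZV R') R)).1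
    ((hFr (fV R') ((frOpen (ZV R) R').ι ≫ fV R) (ZV R') _ (t R R') _ _ (ht R R') R).1
      (fr_baseChange_self Fr frOpen hFr V fV ZV huniv R _)) x

include hFr ht fV in
/-- `t_{RR'}(W_{RR'} ∩ W_{RR″}) ⊆ W_{R'R″}`: on the open `O = W_{RR'} ∩ W_{RR″}` of `W_{RR'}`, `Z_R|_O` is `R″`-framed and a
pull-back of `Z_{R'}` along `O ↪ W_{RR'} → V_{R'}` (★ `IsBaseChangeVia.trans`), so that map lands in `W_{R'R″}` (`hFr`).
[cite: MumfordFogartyKirwan1994, Ch. 7 §2 Proposition 7.6 (pp. 136–138)] -/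
theorem transition_dom (R R' R'' : ι) (x : frOpen (ZV R) R') (hx : x.1 ∈ frOpen (ZV R) R'') :
    t R R' x ∈ frOpen (ZV R') R'' := by
  -- the open `O := W_{RR'} ∩ W_{RR″}` of the scheme `W_{RR'}`
  let O : ((frOpen (ZV R) R' : (V R).Opens) : Scheme.{0}).Opens := (frOpen (ZV R) R').ι ⁻¹ᵁ frOpen (ZV R) R''
  have hxO : x ∈ O := hx
  -- `Z_R|_O` over `O`, a pull-back of `Z_R` along `O.ι ≫ W.ι` and of `Z_{R'}` along `O.ι ≫ t`
  have rO := ((ZV R).baseChange (frOpen (ZV R) R').ι).baseChange_isBaseChangeVia O.ι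
  have rR : (((ZV R).baseChange (frOpen (ZV R) R').ι).baseChange O.ι).IsBaseChangeVia (ZV R)
      (O.ι ≫ (frOpen (ZV R) R').ι) _ _ := rO.trans ((ZV R).baseChange_isBaseChangeVia (frOpen (ZV R) R').ι)
  have rR' : (((ZV R).baseChange (frOpen (ZV R) R').ι).baseChange O.ι).IsBaseChangeVia (ZV R') (O.ι ≫ t R R') _ _ :=
    rO.trans (ht R R')
  -- `R″`-framed: `O ⊆ W_{RR″}`
  have hfr : Fr (((ZV R).baseChange (frOpen (ZV R) R').ι).baseChange O.ι) R'' := by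
    refine (hFr (fV R) (O.ι ≫ (frOpen (ZV R) R').ι ≫ fV R) (ZV R) _ _ _ _ rR R'').2 ?_
    rw [Scheme.Hom.comp_preimage, ι_preimage_eq_top_iff_le]
  -- hence `O.ι ≫ t` lands in `W_{R'R″}`
  have hland := (preimage_eq_top_iff_forall_mem (O.ι ≫ t R R') (frOpen (ZV R') R'')).1
    ((hFr (fV R') (O.ι ≫ (frOpen (ZV R) R').ι ≫ fV R) (ZV R') _ _ _ _ rR' R'').1 hfr) ⟨x, hxO⟩
  rwa [Scheme.Hom.comp_apply, Scheme.Opens.ι_apply] at hland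

include hFr hrep fV ht in
/-- **The cocycle `t_{R'R″} ∘ t_{RR'} = t_{RR″}` on `W_{RR'} ∩ W_{RR″}`** (against test morphisms `a b c` from an open `O ⊆ V_R`, the
shape of ★ `OpensGlueDatum.cocycle`): both sides are morphisms `O ⟶ V_{R″}` along which `Z_R|_O` is a pull-back of `Z_{R″}` (★
`IsBaseChangeVia.trans`, ★ `exists_isBaseChangeVia_of_comp` cancelling the inclusions), hence equal by `hrep R″` (uniqueness; `O` is a
locally Noetherian ℚ-scheme). [cite: MumfordFogartyKirwan1994, Ch. 7 §2 Proposition 7.6 (pp. 136–138)] -/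
theorem transition_cocycle (R R' R'' : ι) (O : (V R).Opens) (a : (O : Scheme.{0}) ⟶ frOpen (ZV R) R')
    (b : (O : Scheme.{0}) ⟶ frOpen (ZV R') R'') (c : (O : Scheme.{0}) ⟶ frOpen (ZV R) R'')
    (ha : a ≫ (frOpen (ZV R) R').ι = O.ι) (hb : b ≫ (frOpen (ZV R') R'').ι = a ≫ t R R')
    (hc : c ≫ (frOpen (ZV R) R'').ι = O.ι) : b ≫ t R' R'' = c ≫ t R R'' := by
  -- `Z_R|_O` and its relation to `Z_R` along `O.ι`
  have rO : ((ZV R).baseChange O.ι).IsBaseChangeVia (ZV R) O.ι _ _ := (ZV R).baseChange_isBaseChangeVia O.ι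
  -- along `c ≫ t R R″`: cancel `O.ι = c ≫ W.ι` against `Z_R|_{W_{RR″}} → Z_R`, then compose with `t R R″`
  have rc : ((ZV R).baseChange O.ι).IsBaseChangeVia (ZV R) (c ≫ (frOpen (ZV R) R'').ι)
      (pullback.fst (ZV R).A.X.hom O.ι) (pullback.fst (ZV R).D.hat.X.hom O.ι) := by rw [hc]; exact rO
  obtain ⟨m₁, mh₁, -, -, r₁⟩ := exists_isBaseChangeVia_of_comp rc ((ZV R).baseChange_isBaseChangeVia (frOpen (ZV R) R'').ι)
  have r₁' : ((ZV R).baseChange O.ι).IsBaseChangeVia (ZV R'') (c ≫ t R R'') _ _ := r₁.trans (ht R R'')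
  -- along `b ≫ t R' R″`: cancel `O.ι = a ≫ W.ι`, compose with `t R R'`, cancel against `Z_{R'}|_{W_{R'R″}} → Z_{R'}`, compose
  have ra : ((ZV R).baseChange O.ι).IsBaseChangeVia (ZV R) (a ≫ (frOpen (ZV R) R').ι)
      (pullback.fst (ZV R).A.X.hom O.ι) (pullback.fst (ZV R).D.hat.X.hom O.ι) := by rw [ha]; exact rO
  obtain ⟨m₂, mh₂, -, -, r₂⟩ := exists_isBaseChangeVia_of_comp ra ((ZV R).baseChange_isBaseChangeVia (frOpen (ZV R) R').ι)
  have r₂' : ((ZV R).baseChange O.ι).IsBaseChangeVia (ZV R') (a ≫ t R R') _ _ := r₂.trans (ht R R')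
  have r₂'' : ((ZV R).baseChange O.ι).IsBaseChangeVia (ZV R') (b ≫ (frOpen (ZV R') R'').ι)
      (m₂ ≫ Gt R R') (mh₂ ≫ Ĝt R R') := by rw [hb]; exact r₂'
  obtain ⟨m₃, mh₃, -, -, r₃⟩ := exists_isBaseChangeVia_of_comp r₂'' ((ZV R').baseChange_isBaseChangeVia (frOpen (ZV R') R'').ι)
  have r₃' : ((ZV R).baseChange O.ι).IsBaseChangeVia (ZV R'') (b ≫ t R' R'') _ _ := r₃.trans (ht R' R'')
  -- `Z_R|_O` is `R″`-framed (`O ⊆ W_{RR″}` through `c`), so `hrep R″` applies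
  have hfr : Fr ((ZV R).baseChange O.ι) R'' := by
    refine (hFr (fV R) (O.ι ≫ fV R) (ZV R) _ _ _ _ rc R'').2 ?_
    rw [Scheme.Hom.comp_preimage, Scheme.Opens.ι_preimage_self, Scheme.Hom.preimage_top]
  obtain ⟨v, -, huniq⟩ := hrep R'' (O.ι ≫ fV R) _ hfr
  exact (huniq _ ⟨_, _, r₃'⟩).trans (huniq _ ⟨_, _, r₁'⟩).symm

/-! ## §3 The glued base `A⁰ = ⋃ V_R`, the glued triple `Z` and its cartesian charts -/

include hFr huniv hrep fV in
/-- **F-8 (8δ), CORE FORM: THE SLICES GLUE, AND THE SLICE TRIPLES GLUE TO A TRIPLE OVER `A⁰ = ⋃ V_R` WITH CARTESIAN CHARTS**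
([MumfordFogartyKirwan1994] Ch. 7 §2 Prop. 7.6, proof p. 138: «the open sets `V_R` … glue along the unique morphisms … the
families `Z_R` glue»).  INPUT (the letters of ★ `SiegelFineModuliScheme.classify_of_openCharts_of_specHom`): open conditions
`Fr`/`frOpen` with their base-change law `hFr` over ℚ-schemes (edition 2); slices `V R` (locally Noetherian ℚ-schemes) carrying
triples `ZV R` satisfying their own condition (`huniv`) and REPRESENTING the condition (`hrep`); the F-3 inputs — the dual-pair
PROVIDER `hdualV` («an abelian scheme over a locally Noetherian ℚ-scheme covered by cartesian charts from the `(ZV R).A` has a dual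
pair») and the slice unit hypotheses `unitV`; `3 ≤ N`, `δ` a type.  OUTPUT: a locally Noetherian ℚ-scheme `M = A⁰`, a triple `Z`
over it, open immersions `j R : V R ⟶ M` over ℚ covering `M` (`hjcov`), overlapping exactly along the conditions (`hglue`), with
cartesian charts `hchart`.  Road: the glue datum of §2 (★ `OpensGlueDatum`), Mathlib gluing of the structure morphisms to `Spec ℚ`
(★ `hom_ext_specRat`), transition RELATIONS of triples (★ `exists_isBaseChangeVia_of_comp`), ★ (σ2)
`exists_glueTriple_of_transitions_of_three_le`. [cite: MumfordFogartyKirwan1994, Ch. 7 §2 Proposition 7.6 (p. 136; proof pp. 136–138)]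
[cite: MumfordFogartyKirwan1994, Ch. 7 §2 Definition 7.2 (p. 129)] [cite: StacksProject, Tag 01JA] -/
theorem exists_glued_of_representedCharts_of_dualV (hN : 3 ≤ N) (hδ : IsPolarizationType δ)
    (hdualV : ∀ ⦃S : Scheme.{0}⦄ [IsLocallyNoetherian S] (_fS : S ⟶ Spec (.of ℚ)) (B : AbelianSchemeOver S),
      (∀ s : S, ∃ (R : ι) (u : V R ⟶ S) (_ : IsOpenImmersion u) (_ : s ∈ Set.range u.base)
        (G : (ZV R).A.X.left ⟶ B.X.left), (ZV R).A.IsBaseChangeVia B u G) → Nonempty B.DualPair)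
    (unitV : ∀ R, Nonempty ((Scheme.Modules.pullback (DualPair.unitHatSlice (ZV R).D)).obj (ZV R).D.P ≅
      SheafOfModules.unit _)) :
    ∃ (M : SchemeOver ℚ) (_ : IsLocallyNoetherian M.left) (Z : PolarizedAbelianSchemeWithLevel g N δ M.left)
      (j : ∀ R, V R ⟶ M.left) (_ : ∀ R, IsOpenImmersion (j R)) (_ : ∀ R, j R ≫ M.hom = fV R)
      (Gc : ∀ R, (ZV R).A.X.left ⟶ Z.A.X.left) (Ĝc : ∀ R, (ZV R).D.hat.X.left ⟶ Z.D.hat.X.left),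
      (∀ R, (ZV R).IsBaseChangeVia Z (j R) (Gc R) (Ĝc R)) ∧
      (∀ R R', (j R') ⁻¹ᵁ (j R).opensRange = frOpen (ZV R') R) ∧
      (⨆ R, (j R).opensRange = ⊤) := by
  classical
  choose t Gt Ĝt ht _huniq using exists_transition Fr frOpen hFr V fV ZV hrep
  let 𝒟 : OpensGlueDatum.{0} :=
    { J := ι
      U := V
      W := fun R R' => frOpen (ZV R) R'
      t := t
      W_self := frOpen_self_eq_top Fr frOpen hFr V fV ZV huniv
      t_self := transition_self Fr frOpen hFr V fV ZV huniv hrep t Gt Ĝt ht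
      t_mem := transition_mem Fr frOpen hFr V fV ZV huniv t Gt Ĝt ht
      dom := transition_dom Fr frOpen hFr V fV ZV t Gt Ĝt ht
      cocycle := transition_cocycle Fr frOpen hFr V fV ZV hrep t Gt Ĝt ht }
  let D : Scheme.GlueData.{0} := 𝒟.glueData
  let q : D.glued ⟶ Spec (.of ℚ) := Scheme.Cover.glueMorphisms D.openCover (fun R => fV R)
    (fun _ _ => hom_ext_specRat _ _)
  have hq : ∀ R, D.ι R ≫ q = fV R := fun R => Scheme.Cover.ι_glueMorphisms D.openCover _ _ R
  haveI hNoeth : IsLocallyNoetherian D.glued := (isLocallyNoetherian_iff_openCover D.openCover).2 fun R =>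
    inferInstanceAs (IsLocallyNoetherian (V R))
  have hjcov : ⨆ R, (D.ι R).opensRange = ⊤ := D.openCover.iSup_opensRange
  have hglue : ∀ R R', (D.ι R') ⁻¹ᵁ (D.ι R).opensRange = frOpen (ZV R') R := by
    intro R R'
    ext x
    change x ∈ (D.ι R') ⁻¹' Set.range (D.ι R) ↔ x ∈ (frOpen (ZV R') R : Set (V R'))
    rw [𝒟.preimage_range_ι R R']
  have hR : ∀ R R', ∃ (θ : pullback (ZV R).A.X.hom (D.f R R') ⟶ pullback (ZV R').A.X.hom (D.f R' R))
      (θhat : ((ZV R).D.baseChange (D.f R R')).hat.X.left ⟶ ((ZV R').D.baseChange (D.f R' R)).hat.X.left),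
      ((ZV R).baseChange (D.f R R')).IsBaseChangeVia ((ZV R').baseChange (D.f R' R)) (D.t R R') θ θhat := by
    intro R R'
    have h₁ : ((ZV R).baseChange (D.f R R')).IsBaseChangeVia (ZV R') (D.t R R' ≫ (frOpen (ZV R') R).ι)
        (Gt R R') (Ĝt R R') := by
      rw [show D.t R R' ≫ (frOpen (ZV R') R).ι = t R R' from 𝒟.glueData_t_ι R R']
      exact ht R R'
    obtain ⟨θ, θhat, -, -, r⟩ := exists_isBaseChangeVia_of_comp h₁ ((ZV R').baseChange_isBaseChangeVia (frOpen (ZV R') R).ι)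
    exact ⟨θ, θhat, r⟩
  choose θ θhat hRel using hR
  -- ★ (σ2) for ANY dual pair `D₀` of the glued abelian scheme (its type is (σ2)'s literal cocycle datum — kept syntactic)
  have key : ∀ D₀ : (⟨fun i => (ZV i).A, θ, fun i j => (hRel i j).1.1, θ_self_eq_id_of_three_le (D := D) ZV θ θhat hRel (fun R => fV R) hN,
      relativeT'_cocycle_of_three_le (D := D) ZV θ θhat hRel (fun R => fV R) hN⟩ : CocycleDatum D).abelianScheme.DualPair,
      ∃ (M : SchemeOver ℚ) (_ : IsLocallyNoetherian M.left) (Z : PolarizedAbelianSchemeWithLevel g N δ M.left)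
        (j : ∀ R, V R ⟶ M.left) (_ : ∀ R, IsOpenImmersion (j R)) (_ : ∀ R, j R ≫ M.hom = fV R)
        (Gc : ∀ R, (ZV R).A.X.left ⟶ Z.A.X.left) (Ĝc : ∀ R, (ZV R).D.hat.X.left ⟶ Z.D.hat.X.left),
        (∀ R, (ZV R).IsBaseChangeVia Z (j R) (Gc R) (Ĝc R)) ∧
        (∀ R R', (j R') ⁻¹ᵁ (j R).opensRange = frOpen (ZV R') R) ∧ (⨆ R, (j R).opensRange = ⊤) := fun D₀ => by
    obtain ⟨Z, -, -, G, Ĝ, hchart⟩ := exists_glueTriple_of_transitions_of_three_le (D := D) ZV θ θhat hRel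
      (fun R => fV R) hN D₀ hδ unitV
    exact ⟨Over.mk q, hNoeth, Z, fun R => D.ι R, fun R => inferInstanceAs (IsOpenImmersion (D.ι R)), hq, G, Ĝ, hchart,
      hglue, hjcov⟩
  -- the dual pair from the provider: the glued abelian scheme is covered by the cartesian charts `(ZV R).A ↪ ⋃ (ZV R).A`
  -- (★ `CocycleDatum.isBaseChangeVia_abelianScheme`, Mathlib `Scheme.GlueData.ι_jointly_surjective`)
  refine key (hdualV q _ fun s => ?_).some
  obtain ⟨i, x, hx⟩ := D.ι_jointly_surjective s
  exact ⟨i, D.ι i, inferInstance, ⟨x, hx⟩, _,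
    CocycleDatum.isBaseChangeVia_abelianScheme (⟨fun i => (ZV i).A, θ, fun i j => (hRel i j).1.1,
      θ_self_eq_id_of_three_le (D := D) ZV θ θhat hRel (fun R => fV R) hN, relativeT'_cocycle_of_three_le (D := D) ZV θ θhat hRel (fun R => fV R) hN⟩ :
      CocycleDatum D) i⟩

include hFr huniv hrep fV in
/-- **F-8 (8δ) IN THE F-3 LETTER OF RECORD** (pen B-p14 (g18) 09:11:33Z, «[MumfordFogartyKirwan1994] Cor. 6.8 ZARISKI-LOCALLY ON THE
BASE»): with the slices PROJECTIVE over `V R` (`hprojV` — ★ `Polarization.isProjective_of_frame_LDelta_three` at the slices) and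
`hdual`: «an abelian scheme over a locally Noetherian ℚ-scheme which is, Zariski-locally on the base, a pull-back of a PROJECTIVE
abelian scheme has a dual pair», the slices glue as in `exists_glued_of_representedCharts_of_dualV`.
[cite: MumfordFogartyKirwan1994, Ch. 7 §2 Proposition 7.6 (p. 136; proof pp. 136–138)] [cite: MumfordFogartyKirwan1994, Ch. 6 §1 Cor. 6.8 (p. 118)] -/
theorem exists_glued_of_representedCharts_of_specHom (hN : 3 ≤ N) (hδ : IsPolarizationType δ)
    (hprojV : ∀ R, IsProjective (ZV R).A.X.hom)
    (hdual : ∀ ⦃S : Scheme.{0}⦄ [IsLocallyNoetherian S] (_fS : S ⟶ Spec (.of ℚ)) (A : AbelianSchemeOver S),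
      (∀ s : S, ∃ (U : Scheme.{0}) (i : U ⟶ S) (_ : IsOpenImmersion i) (_ : s ∈ Set.range i.base)
        (B : AbelianSchemeOver U) (G : B.X.left ⟶ A.X.left), B.IsBaseChangeVia A i G ∧ IsProjective B.X.hom) →
      Nonempty A.DualPair)
    (unitV : ∀ R, Nonempty ((Scheme.Modules.pullback (DualPair.unitHatSlice (ZV R).D)).obj (ZV R).D.P ≅
      SheafOfModules.unit _)) :
    ∃ (M : SchemeOver ℚ) (_ : IsLocallyNoetherian M.left) (Z : PolarizedAbelianSchemeWithLevel g N δ M.left)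
      (j : ∀ R, V R ⟶ M.left) (_ : ∀ R, IsOpenImmersion (j R)) (_ : ∀ R, j R ≫ M.hom = fV R)
      (Gc : ∀ R, (ZV R).A.X.left ⟶ Z.A.X.left) (Ĝc : ∀ R, (ZV R).D.hat.X.left ⟶ Z.D.hat.X.left),
      (∀ R, (ZV R).IsBaseChangeVia Z (j R) (Gc R) (Ĝc R)) ∧
      (∀ R R', (j R') ⁻¹ᵁ (j R).opensRange = frOpen (ZV R') R) ∧
      (⨆ R, (j R).opensRange = ⊤) :=
  exists_glued_of_representedCharts_of_dualV Fr frOpen hFr V fV ZV huniv hrep hN hδ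
    (fun _ _ fS B h => hdual fS B fun s => by
      obtain ⟨R, u, hu, hs, G, hG⟩ := h s
      exact ⟨V R, u, hu, hs, (ZV R).A, G, hG, hprojV R⟩)
    unitV

end Slices

/-! ## Edition 1's head (absolute `hFr`, dual pairs for all abelian schemes) — kept for ★ `SiegelFineModuliSchemeOfRepresentedCharts` -/

section Absolute

variable {ι : Type} (Fr : ∀ ⦃T : Scheme.{0}⦄, PolarizedAbelianSchemeWithLevel g N δ T → ι → Prop)
  (frOpen : ∀ ⦃T : Scheme.{0}⦄, PolarizedAbelianSchemeWithLevel g N δ T → ι → T.Opens)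
  (hFr : ∀ ⦃T T' : Scheme.{0}⦄ [IsLocallyNoetherian T] [IsLocallyNoetherian T']
    (P' : PolarizedAbelianSchemeWithLevel g N δ T) (P'' : PolarizedAbelianSchemeWithLevel g N δ T') (u : T' ⟶ T)
    (G : P''.A.X.left ⟶ P'.A.X.left) (Ĝ : P''.D.hat.X.left ⟶ P'.D.hat.X.left),
    P''.IsBaseChangeVia P' u G Ĝ → ∀ R, (Fr P'' R ↔ u ⁻¹ᵁ frOpen P' R = ⊤))
  (V : ι → Scheme.{0}) [∀ R, IsLocallyNoetherian (V R)] (fV : ∀ R, V R ⟶ Spec (.of ℚ))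
  (ZV : ∀ R, PolarizedAbelianSchemeWithLevel g N δ (V R)) (huniv : ∀ R, Fr (ZV R) R)
  (hrep : ∀ R ⦃T : Scheme.{0}⦄ [IsLocallyNoetherian T] (_fT : T ⟶ Spec (.of ℚ))
    (P' : PolarizedAbelianSchemeWithLevel g N δ T), Fr P' R →
    ∃! v : T ⟶ V R, ∃ (G : P'.A.X.left ⟶ (ZV R).A.X.left) (Ĝ : P'.D.hat.X.left ⟶ (ZV R).D.hat.X.left),
      P'.IsBaseChangeVia (ZV R) v G Ĝ)

include hFr huniv hrep in
/-- Edition 1's head: the open-sub-functor clause `hFr` for ALL locally Noetherian test schemes and a dual pair for EVERY abelian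
scheme (`hdual`) — a corollary of `exists_glued_of_representedCharts_of_dualV`.
[cite: MumfordFogartyKirwan1994, Ch. 7 §2 Proposition 7.6 (p. 136; proof pp. 136–138)] -/
theorem exists_glued_of_representedCharts (hN : 3 ≤ N) (hδ : IsPolarizationType δ)
    (hdual : ∀ ⦃S : Scheme.{0}⦄ (A : AbelianSchemeOver S), Nonempty A.DualPair)
    (unitV : ∀ R, Nonempty ((Scheme.Modules.pullback (DualPair.unitHatSlice (ZV R).D)).obj (ZV R).D.P ≅
      SheafOfModules.unit _)) :
    ∃ (M : SchemeOver ℚ) (_ : IsLocallyNoetherian M.left) (Z : PolarizedAbelianSchemeWithLevel g N δ M.left)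
      (j : ∀ R, V R ⟶ M.left) (_ : ∀ R, IsOpenImmersion (j R)) (_ : ∀ R, j R ≫ M.hom = fV R)
      (Gc : ∀ R, (ZV R).A.X.left ⟶ Z.A.X.left) (Ĝc : ∀ R, (ZV R).D.hat.X.left ⟶ Z.D.hat.X.left),
      (∀ R, (ZV R).IsBaseChangeVia Z (j R) (Gc R) (Ĝc R)) ∧
      (∀ R R', (j R') ⁻¹ᵁ (j R).opensRange = frOpen (ZV R') R) ∧
      (⨆ R, (j R).opensRange = ⊤) :=
  exists_glued_of_representedCharts_of_dualV Fr frOpen (fun _ _ _ _ _ _ P' P'' u G Ĝ h R => hFr P' P'' u G Ĝ h R) V fV ZV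
    huniv hrep hN hδ (fun _ _ _ B _ => hdual B) unitV

end Absolute



end Literature.AlgebraicGeometry.ModuliOfAbelianVarieties

end
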